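import Summits.AtomisticToContinuum.Crystallization.Theorems.ChargedEnergyGapChartDialK

/-!
# `ChargedEnergyGap` · the CHART DIAL, part L: KISSING-PATTERN COMBINATORICS for the square lemma
(decomp-a2c lens-3 g39 node «ChargeFreeGap»; pattern half — no configuration `Q` appears)

Part K split the dictionary `ChargeFreeCharted θ ↔ ChargeFreeShaped θ ∧ ChargeFreeGapped` and proved the GAP
conjunct from SHAPE alone for `θ ≤ 1/8` (one matched vertex within `45°` of the intruder).  At the dial of record
`θ = 3/20` one vertex is not enough (`45° + arcsin (3/20) > 52·5°`); the FOUR-RINGS of charge-freeness are.  Parts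
L (patterns), M (cap-or-square and the two estimates) and N (bond structure and assembly) prove
`θ ≤ 3/20 → IsChargeFree (1/100) p → BondChartedAt θ Q p → GappedAt Q p`, whence
`ChargeFreeCharted θ ↔ ChargeFreeShaped θ` for every `θ ≤ 3/20` (part N).

§1 PATTERN COMBINATORICS (kernel-decided on the integer models `fccInt`, `hcpInt`, transported to the rotated real
   patterns): every vertex of either kissing pattern has at most FOUR other vertices at distance `< √2`
   (`ncard_near_le_four`) — the cuboctahedron and anticuboctahedron graphs are `4`-regular, non-edges `≥ √2`.
§2 TWO ALTERNATIVES on the integer models: for every `d ∈ ℝ³`, EITHER an integer pattern vector `v` has a large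
   inner product with `d` (FCC `⟪d, intVec v⟫ ≥ 1·1173·‖d‖`, from the two largest `|coordinates|`:
   `a + √((1 − a²)/2) ≥ 1·1321 > 79/100·√2` for `a ≤ 39/40`; HCP `≥ 3·1·1173·‖d‖`), OR a coordinate of `d` — for HCP
   in the lower half-space `x + y + z < 0`, of the REFLECTED `d` — is `≥ (39/40)·‖d‖`: `d` points along the normal
   of a square face (`exists_fccInt_inner_ge_or_coord`, `exists_hcpInt_inner_ge_or_coord`; the HCP proof is the
   reflection bookkeeping of part F).
§3 NUMERIC ROOTS: `√2 ≤ 1·4143`, `√18 ≤ 4·2429`, `√2·√2 = 2`, `√2·√18 = 6`.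

No `sorry`, no new axiom, no instance / notation / option; no new definition.
-/

noncomputable section

open Literature.MathematicalPhysics.StatisticalMechanics
open Literature.Geometry.DiscreteGeometry
open Summit.AtomisticToContinuum.Crystallization.Theses.PricedLinkCensus
open Summit.AtomisticToContinuum.Crystallization.Theorems.ChargedEnergyGapNegative
open RealInnerProductSpace
namespace Summit.AtomisticToContinuum.Crystallization.Theorems.ChargedEnergyGapChartDial

/-! ## §1 Pattern combinatorics: at most four pattern vectors within `√2` of a pattern vector -/

section patterns

/-- `intVec` is additive. -/
theorem intVec_add (v w : Fin 3 → ℤ) : intVec (v + w) = intVec v + intVec w := by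
  ext i; simp [intVec]

/-- The squared norm of `ℝ³` in coordinates (part F's, restated for use here). -/
theorem norm_sq_coord' (d : E3) : ‖d‖ ^ 2 = d 0 ^ 2 + d 1 ^ 2 + d 2 ^ 2 := by
  rw [EuclideanSpace.norm_eq, Real.sq_sqrt (by positivity), Fin.sum_univ_three]
  simp only [Real.norm_eq_abs, sq_abs]

/-- Distances inside a scaled integer pattern. -/
theorem dist_scaled_intVec {N : ℕ} (hN : N ≠ 0) (v w : Fin 3 → ℤ) :
    dist ((Real.sqrt N)⁻¹ • intVec v : E3) ((Real.sqrt N)⁻¹ • intVec w) =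
      (Real.sqrt N)⁻¹ * Real.sqrt (sqNormInt (v - w) : ℝ) := by
  have hpos : (0 : ℝ) < Real.sqrt N := by positivity
  rw [dist_eq_norm, ← smul_sub, intVec_sub, norm_smul, norm_inv, Real.norm_of_nonneg hpos.le, norm_intVec]

/-- Pattern EDGES: integer squared distance `N` means real distance `1`. -/
theorem dist_scaled_eq_one {N : ℕ} (hN : N ≠ 0) {v w : Fin 3 → ℤ} (h : sqNormInt (v - w) = N) :
    dist ((Real.sqrt N)⁻¹ • intVec v : E3) ((Real.sqrt N)⁻¹ • intVec w) = 1 := by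
  rw [dist_scaled_intVec hN, h, Int.cast_natCast, inv_mul_cancel₀ (by positivity)]

/-- Real distance `< √2` means integer squared distance `< 2N`. -/
theorem sqNormInt_lt_of_dist_lt {N : ℕ} (hN : N ≠ 0) {v w : Fin 3 → ℤ}
    (h : dist ((Real.sqrt N)⁻¹ • intVec v : E3) ((Real.sqrt N)⁻¹ • intVec w) < Real.sqrt 2) :
    sqNormInt (v - w) < 2 * (N : ℤ) := by
  rw [dist_scaled_intVec hN] at h
  by_contra hc
  push Not at hc
  have hpos : (0 : ℝ) < Real.sqrt N := by positivity
  have hle : Real.sqrt 2 ≤ (Real.sqrt N)⁻¹ * Real.sqrt (sqNormInt (v - w) : ℝ) := by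
    rw [le_inv_mul_iff₀ hpos, ← Real.sqrt_mul (Nat.cast_nonneg N)]
    exact Real.sqrt_le_sqrt (by exact_mod_cast (by linarith : (N : ℤ) * 2 ≤ sqNormInt (v - w)))
  linarith

/-- FCC: every vertex of the cuboctahedron has at most four other vertices at integer squared distance `< 4`. -/
theorem card_near_fccInt :
    ∀ v₀ ∈ fccInt, (fccInt.filter fun v => v ≠ v₀ ∧ sqNormInt (v₀ - v) < 2 * ((2 : ℕ) : ℤ)).card ≤ 4 := by
  decide

/-- HCP: every vertex of the anticuboctahedron has at most four other vertices at integer squared distance `< 36`. -/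
theorem card_near_hcpInt :
    ∀ v₀ ∈ hcpInt, (hcpInt.filter fun v => v ≠ v₀ ∧ sqNormInt (v₀ - v) < 2 * ((18 : ℕ) : ℤ)).card ≤ 4 := by
  decide

/-- Transport of a near-count bound from the integer model to a rotated scaled pattern. -/
theorem ncard_near_le_of_int {S : Finset (Fin 3 → ℤ)} {N : ℕ} (hN : N ≠ 0) {k : ℕ}
    (hS : ∀ v₀ ∈ S, (S.filter fun v => v ≠ v₀ ∧ sqNormInt (v₀ - v) < 2 * (N : ℤ)).card ≤ k)
    (A : E3 →ₗᵢ[ℝ] E3) {y₀ : E3} (hy₀ : y₀ ∈ (scaledPattern S N).image A) :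
    {y : E3 | y ∈ (scaledPattern S N).image A ∧ y ≠ y₀ ∧ dist y₀ y < Real.sqrt 2}.ncard ≤ k := by
  classical
  obtain ⟨x₀, hx₀, hAx₀⟩ := Finset.mem_image.1 hy₀
  obtain ⟨v₀, hv₀, hxv₀⟩ := Finset.mem_image.1 hx₀
  let f : (Fin 3 → ℤ) → E3 := fun v => A ((Real.sqrt N)⁻¹ • intVec v)
  have hf0 : f v₀ = y₀ := by simp only [f]; rw [hxv₀, hAx₀]
  have hsub : {y : E3 | y ∈ (scaledPattern S N).image A ∧ y ≠ y₀ ∧ dist y₀ y < Real.sqrt 2} ⊆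
      ↑((S.filter fun v => v ≠ v₀ ∧ sqNormInt (v₀ - v) < 2 * (N : ℤ)).image f) := by
    rintro y ⟨hy, hne, hd⟩
    obtain ⟨x, hx, rfl⟩ := Finset.mem_image.1 hy
    obtain ⟨v, hv, rfl⟩ := Finset.mem_image.1 hx
    refine Finset.mem_coe.2 (Finset.mem_image.2 ⟨v, Finset.mem_filter.2 ⟨hv, ?_, ?_⟩, rfl⟩)
    · rintro rfl; exact hne hf0
    · rw [← hf0] at hd
      have hd' : dist ((Real.sqrt N)⁻¹ • intVec v₀ : E3) ((Real.sqrt N)⁻¹ • intVec v) < Real.sqrt 2 := by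
        rwa [A.isometry.dist_eq] at hd
      exact sqNormInt_lt_of_dist_lt hN hd'
  calc {y : E3 | y ∈ (scaledPattern S N).image A ∧ y ≠ y₀ ∧ dist y₀ y < Real.sqrt 2}.ncard
      ≤ (↑((S.filter fun v => v ≠ v₀ ∧ sqNormInt (v₀ - v) < 2 * (N : ℤ)).image f) : Set E3).ncard :=
        Set.ncard_le_ncard hsub (Finset.finite_toSet _)
    _ = ((S.filter fun v => v ≠ v₀ ∧ sqNormInt (v₀ - v) < 2 * (N : ℤ)).image f).card := Set.ncard_coe_finset _
    _ ≤ (S.filter fun v => v ≠ v₀ ∧ sqNormInt (v₀ - v) < 2 * (N : ℤ)).card := Finset.card_image_le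
    _ ≤ k := hS v₀ hv₀

/-- **FOUR-REGULARITY of the kissing patterns** (rotated): at most four pattern vectors other than `y₀` lie within
`√2` of a pattern vector `y₀`. -/
theorem ncard_near_le_four {P : Finset E3} (hP : P = fccKissingPattern ∨ P = hcpKissingPattern)
    (A : E3 →ₗᵢ[ℝ] E3) {y₀ : E3} (hy₀ : y₀ ∈ P.image A) :
    {y : E3 | y ∈ P.image A ∧ y ≠ y₀ ∧ dist y₀ y < Real.sqrt 2}.ncard ≤ 4 := by
  rcases hP with rfl | rfl
  · exact ncard_near_le_of_int (by norm_num) card_near_fccInt A hy₀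
  · exact ncard_near_le_of_int (by norm_num) card_near_hcpInt A hy₀

/-- Pattern vectors are unit vectors (both patterns, rotated). -/
theorem norm_eq_one_of_mem_image {P : Finset E3} (hP : P = fccKissingPattern ∨ P = hcpKissingPattern)
    (A : E3 →ₗᵢ[ℝ] E3) {y : E3} (hy : y ∈ P.image A) : ‖y‖ = 1 := by
  obtain ⟨w, hw, rfl⟩ := Finset.mem_image.1 hy
  rw [A.norm_map]
  rcases hP with rfl | rfl
  · exact norm_eq_one_of_mem_fccKissingPattern hw
  · exact norm_eq_one_of_mem_hcpKissingPattern hw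

end patterns

/-! ## §2 Two alternatives on the integer models: a near pattern vector, or a square normal -/

section alternatives

/-- The key planar inequality of the FCC alternative: if the two largest `|coordinates|` are both `< 39/40·‖d‖`,
their sum is `≥ 1·1173·‖d‖ > (79/100)·√2·‖d‖`. -/
theorem abs_add_abs_ge_of_coord_lt {x y z n : ℝ} (hn : 0 ≤ n) (hsq : n ^ 2 = x ^ 2 + y ^ 2 + z ^ 2)
    (hzx : |z| ≤ |x|) (hzy : |z| ≤ |y|) (hx : |x| < 39 / 40 * n) (hy : |y| < 39 / 40 * n) :
    11173 / 10000 * n ≤ |x| + |y| := by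
  have hX := abs_nonneg x; have hY := abs_nonneg y; have hZ := abs_nonneg z
  have hsq' : n ^ 2 = |x| ^ 2 + |y| ^ 2 + |z| ^ 2 := by rw [sq_abs, sq_abs, sq_abs]; exact hsq
  have hz2x : |z| ^ 2 ≤ |x| ^ 2 := pow_le_pow_left₀ hZ hzx 2
  have hz2y : |z| ^ 2 ≤ |y| ^ 2 := pow_le_pow_left₀ hZ hzy 2
  by_contra hc
  push Not at hc
  rcases le_total |x| |y| with hxy | hyx
  · have h3 : n ^ 2 ≤ 3 * |y| ^ 2 := by nlinarith
    nlinarith [mul_nonneg (sub_nonneg.2 hxy) hX, sq_nonneg (|x| - (11173 / 10000 * n - |y|)),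
      mul_nonneg (mul_nonneg hn hn) (sub_nonneg.2 hy.le)]
  · have h3 : n ^ 2 ≤ 3 * |x| ^ 2 := by nlinarith
    nlinarith [mul_nonneg (sub_nonneg.2 hyx) hY, sq_nonneg (|y| - (11173 / 10000 * n - |x|)),
      mul_nonneg (mul_nonneg hn hn) (sub_nonneg.2 hx.le)]

/-- **FCC, integer form**: either a minimal vector `v` of `D₃` has `⟪d, v⟫ ≥ 1·1173·‖d‖` (`> (79/100)·‖v‖·‖d‖`), or some
coordinate of `d` has absolute value `≥ (39/40)·‖d‖`. -/
theorem exists_fccInt_inner_ge_or_coord (d : E3) :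
    (∃ v ∈ fccInt, 11173 / 10000 * ‖d‖ ≤ ⟪d, intVec v⟫) ∨ (∃ k : Fin 3, 39 / 40 * ‖d‖ ≤ |d k|) := by
  by_cases hk : ∃ k : Fin 3, 39 / 40 * ‖d‖ ≤ |d k|
  · exact Or.inr hk
  left
  push Not at hk
  have hn := norm_nonneg d
  have hsq := norm_sq_coord' d
  have m01 : ![sgnZ (d 0), sgnZ (d 1), 0] ∈ fccInt := by
    rcases sgnZ_cases (d 0) with h0 | h0 <;> rcases sgnZ_cases (d 1) with h1 | h1 <;> rw [h0, h1] <;> decide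
  have m02 : ![sgnZ (d 0), 0, sgnZ (d 2)] ∈ fccInt := by
    rcases sgnZ_cases (d 0) with h0 | h0 <;> rcases sgnZ_cases (d 2) with h1 | h1 <;> rw [h0, h1] <;> decide
  have m12 : ![0, sgnZ (d 1), sgnZ (d 2)] ∈ fccInt := by
    rcases sgnZ_cases (d 1) with h0 | h0 <;> rcases sgnZ_cases (d 2) with h1 | h1 <;> rw [h0, h1] <;> decide
  have i01 : ⟪d, intVec ![sgnZ (d 0), sgnZ (d 1), 0]⟫ = |d 0| + |d 1| := by
    rw [inner_intVec_coord]; simp [sgnZ_mul_eq_abs]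
  have i02 : ⟪d, intVec ![sgnZ (d 0), 0, sgnZ (d 2)]⟫ = |d 0| + |d 2| := by
    rw [inner_intVec_coord]; simp [sgnZ_mul_eq_abs]
  have i12 : ⟪d, intVec ![0, sgnZ (d 1), sgnZ (d 2)]⟫ = |d 1| + |d 2| := by
    rw [inner_intVec_coord]; simp [sgnZ_mul_eq_abs]
  rcases le_total |d 2| |d 0| with h20 | h02
  · rcases le_total |d 2| |d 1| with h21 | h12
    · exact ⟨_, m01, by rw [i01]; exact abs_add_abs_ge_of_coord_lt hn hsq h20 h21 (hk 0) (hk 1)⟩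
    · exact ⟨_, m02, by
        rw [i02]; exact abs_add_abs_ge_of_coord_lt hn (by rw [hsq]; ring) (h12.trans h20) h12 (hk 0) (hk 2)⟩
  · rcases le_total |d 0| |d 1| with h01 | h10
    · exact ⟨_, m12, by
        rw [i12]; exact abs_add_abs_ge_of_coord_lt hn (by rw [hsq]; ring) h01 h02 (hk 1) (hk 2)⟩
    · exact ⟨_, m02, by
        rw [i02]; exact abs_add_abs_ge_of_coord_lt hn (by rw [hsq]; ring) h10 (h10.trans h02) (hk 0) (hk 2)⟩

/-- A coordinate `≤ −(39/40)·‖d‖` is incompatible with `d₀ + d₁ + d₂ ≥ 0` unless `d = 0`. -/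
theorem eq_zero_of_coord_le_of_sum_nonneg {d : E3} (hs : 0 ≤ d 0 + d 1 + d 2) {k : Fin 3}
    (hk : d k ≤ -(39 / 40 * ‖d‖)) : d = 0 := by
  have hn := norm_nonneg d
  have hsq := norm_sq_coord' d
  have hk' : d 0 ≤ -(39 / 40 * ‖d‖) ∨ d 1 ≤ -(39 / 40 * ‖d‖) ∨ d 2 ≤ -(39 / 40 * ‖d‖) := by
    fin_cases k
    exacts [Or.inl hk, Or.inr (Or.inl hk), Or.inr (Or.inr hk)]
  have h0 : ‖d‖ ^ 2 ≤ 0 := by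
    rcases hk' with h | h | h
    · nlinarith [sq_nonneg (d 1 - d 2)]
    · nlinarith [sq_nonneg (d 0 - d 2)]
    · nlinarith [sq_nonneg (d 0 - d 1)]
  exact norm_eq_zero.1 (by nlinarith)

/-- **HCP, integer form on the upper half-space** `d₀ + d₁ + d₂ ≥ 0`: either one of the NINE shared vectors `v`
(`‖v‖ = 3√2`) has `⟪d, v⟫ ≥ 3·1·1173·‖d‖`, or a coordinate of `d` is `≥ (39/40)·‖d‖` (normal of an upper square). -/
theorem exists_hcpInt_inner_ge_or_coord_of_sum_nonneg (d : E3) (hs : 0 ≤ d 0 + d 1 + d 2) :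
    (∃ v ∈ hcpInt, v 0 + v 1 + v 2 ≥ 0 ∧ 3 * (11173 / 10000) * ‖d‖ ≤ ⟪d, intVec v⟫) ∨
    (∃ k : Fin 3, 39 / 40 * ‖d‖ ≤ d k) := by
  have hn := norm_nonneg d
  have hsq := norm_sq_coord' d
  -- the degenerate case `d = 0`
  have hzero : d = 0 → (∃ v ∈ hcpInt, v 0 + v 1 + v 2 ≥ 0 ∧ 3 * (11173 / 10000) * ‖d‖ ≤ ⟪d, intVec v⟫) ∨
      (∃ k : Fin 3, 39 / 40 * ‖d‖ ≤ d k) := by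
    rintro rfl
    exact Or.inl ⟨![3, 3, 0], by decide, by decide, by simp⟩
  rcases exists_fccInt_inner_ge_or_coord d with ⟨v, hv, h⟩ | ⟨k, hk⟩
  · rw [inner_intVec_coord] at h
    simp only [fccInt, Finset.mem_insert, Finset.mem_singleton] at hv
    rcases hv with rfl | rfl | rfl | rfl | rfl | rfl | rfl | rfl | rfl | rfl | rfl | rfl <;>
      simp only [Matrix.cons_val_zero, Matrix.cons_val_one, Matrix.cons_val_two, Matrix.head_cons,
        Matrix.tail_cons, Int.cast_one, Int.cast_neg, Int.cast_zero] at h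
    · exact Or.inl ⟨![3, 3, 0], by decide, by decide, by rw [inner_intVec_coord]; simp; linarith⟩
    · exact Or.inl ⟨![3, -3, 0], by decide, by decide, by rw [inner_intVec_coord]; simp; linarith⟩
    · exact Or.inl ⟨![-3, 3, 0], by decide, by decide, by rw [inner_intVec_coord]; simp; linarith⟩
    · -- `(-1,-1,0)`: forces `d = 0`
      refine hzero (norm_eq_zero.1 ?_)
      have h2 : ‖d‖ ≤ d 2 := by linarith
      nlinarith [sq_nonneg (d 0), sq_nonneg (d 1)]
    · exact Or.inl ⟨![3, 0, 3], by decide, by decide, by rw [inner_intVec_coord]; simp; linarith⟩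
    · exact Or.inl ⟨![3, 0, -3], by decide, by decide, by rw [inner_intVec_coord]; simp; linarith⟩
    · exact Or.inl ⟨![-3, 0, 3], by decide, by decide, by rw [inner_intVec_coord]; simp; linarith⟩
    · refine hzero (norm_eq_zero.1 ?_)
      have h2 : ‖d‖ ≤ d 1 := by linarith
      nlinarith [sq_nonneg (d 0), sq_nonneg (d 2)]
    · exact Or.inl ⟨![0, 3, 3], by decide, by decide, by rw [inner_intVec_coord]; simp; linarith⟩
    · exact Or.inl ⟨![0, 3, -3], by decide, by decide, by rw [inner_intVec_coord]; simp; linarith⟩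
    · exact Or.inl ⟨![0, -3, 3], by decide, by decide, by rw [inner_intVec_coord]; simp; linarith⟩
    · refine hzero (norm_eq_zero.1 ?_)
      have h2 : ‖d‖ ≤ d 0 := by linarith
      nlinarith [sq_nonneg (d 1), sq_nonneg (d 2)]
  · by_cases hk0 : 0 ≤ d k
    · exact Or.inr ⟨k, by rwa [abs_of_nonneg hk0] at hk⟩
    · push Not at hk0
      rw [abs_of_neg hk0] at hk
      exact hzero (eq_zero_of_coord_le_of_sum_nonneg hs (k := k) (by linarith))

/-- **HCP, integer form, all of `ℝ³`**: either a pattern vector `v ∈ hcpInt` has `⟪d, v⟫ ≥ 3·1·1173·‖d‖`, or `d` is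
near the normal of an UPPER square (`d_k ≥ (39/40)‖d‖`, upper half-space) or of a LOWER square (its mirror image in
the plane `x + y + z = 0`: `d_k − (2/3)(d₀ + d₁ + d₂) ≥ (39/40)‖d‖`, lower half-space). -/
theorem exists_hcpInt_inner_ge_or_coord (d : E3) :
    (∃ v ∈ hcpInt, 3 * (11173 / 10000) * ‖d‖ ≤ ⟪d, intVec v⟫) ∨
    (∃ k : Fin 3, 39 / 40 * ‖d‖ ≤ d k ∧ 0 ≤ d 0 + d 1 + d 2) ∨
    (∃ k : Fin 3, 39 / 40 * ‖d‖ ≤ d k - 2 / 3 * (d 0 + d 1 + d 2) ∧ d 0 + d 1 + d 2 < 0) := by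
  by_cases hs : 0 ≤ d 0 + d 1 + d 2
  · rcases exists_hcpInt_inner_ge_or_coord_of_sum_nonneg d hs with ⟨v, hv, -, h⟩ | ⟨k, hk⟩
    · exact Or.inl ⟨v, hv, h⟩
    · exact Or.inr (Or.inl ⟨k, hk, hs⟩)
  · push Not at hs
    -- reflect `d` in the plane `x + y + z = 0`
    set s : ℝ := d 0 + d 1 + d 2 with hsdef
    set d' : E3 := d - (2 / 3 * s) • intVec ![1, 1, 1] with hd'
    have hc : ∀ l : Fin 3, d' l = d l - 2 / 3 * s := by
      intro l; fin_cases l <;> simp [hd', intVec]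
    have hs' : 0 ≤ d' 0 + d' 1 + d' 2 := by rw [hc, hc, hc]; linarith
    have hnorm : ‖d'‖ = ‖d‖ := by
      have h1 : ‖d'‖ ^ 2 = ‖d‖ ^ 2 := by
        rw [norm_sq_coord', norm_sq_coord', hc, hc, hc, hsdef]; ring
      nlinarith [norm_nonneg d, norm_nonneg d']
    rcases exists_hcpInt_inner_ge_or_coord_of_sum_nonneg d' hs' with ⟨v, hv, hvs, h⟩ | ⟨k, hk⟩
    · left
      rw [hnorm, inner_intVec_coord, hc, hc, hc] at h
      simp only [hcpInt, Finset.mem_insert, Finset.mem_singleton] at hv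
      rcases hv with rfl | rfl | rfl | rfl | rfl | rfl | rfl | rfl | rfl | rfl | rfl | rfl <;>
        simp only [Matrix.cons_val_zero, Matrix.cons_val_one, Matrix.cons_val_two, Matrix.head_cons,
          Matrix.tail_cons, Int.cast_ofNat, Int.cast_neg, Int.cast_zero, Int.cast_one] at h hvs
      -- hexagonal vectors are fixed by the reflection
      · exact ⟨![3, -3, 0], by decide, by rw [inner_intVec_coord]; simp; linarith⟩
      · exact ⟨![-3, 3, 0], by decide, by rw [inner_intVec_coord]; simp; linarith⟩
      · exact ⟨![3, 0, -3], by decide, by rw [inner_intVec_coord]; simp; linarith⟩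
      · exact ⟨![-3, 0, 3], by decide, by rw [inner_intVec_coord]; simp; linarith⟩
      · exact ⟨![0, 3, -3], by decide, by rw [inner_intVec_coord]; simp; linarith⟩
      · exact ⟨![0, -3, 3], by decide, by rw [inner_intVec_coord]; simp; linarith⟩
      -- the upper triangle maps to the lower one
      · exact ⟨![-1, -1, -4], by decide, by rw [inner_intVec_coord]; simp; linarith⟩
      · exact ⟨![-1, -4, -1], by decide, by rw [inner_intVec_coord]; simp; linarith⟩
      · exact ⟨![-4, -1, -1], by decide, by rw [inner_intVec_coord]; simp; linarith⟩
      -- the lower triangle has negative coordinate sum (excluded by `hvs`)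
      · norm_num at hvs
      · norm_num at hvs
      · norm_num at hvs
    · right; right
      refine ⟨k, ?_, hs⟩
      rw [hnorm, hc] at hk
      exact hk

end alternatives

/-! ## §3 Numeric roots -/

/-- `√2 ≤ 1·4143`. -/
theorem sqrt_two_le : Real.sqrt 2 ≤ 14143 / 10000 :=
  calc Real.sqrt 2 ≤ Real.sqrt ((14143 / 10000) ^ 2) := Real.sqrt_le_sqrt (by norm_num)
    _ = 14143 / 10000 := Real.sqrt_sq (by norm_num)

/-- `√18 ≤ 4·2429`. -/
theorem sqrt_eighteen_le : Real.sqrt 18 ≤ 42429 / 10000 :=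
  calc Real.sqrt 18 ≤ Real.sqrt ((42429 / 10000) ^ 2) := Real.sqrt_le_sqrt (by norm_num)
    _ = 42429 / 10000 := Real.sqrt_sq (by norm_num)

/-- `√2·√2 = 2`. -/
theorem sqrt_two_mul_sqrt_two : Real.sqrt 2 * Real.sqrt 2 = 2 := Real.mul_self_sqrt (by norm_num)

/-- `√2·√18 = 6`. -/
theorem sqrt_two_mul_sqrt_eighteen : Real.sqrt 2 * Real.sqrt 18 = 6 := by
  rw [← Real.sqrt_mul (by norm_num), show (2 : ℝ) * 18 = 6 ^ 2 by norm_num, Real.sqrt_sq (by norm_num)]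

end Summit.AtomisticToContinuum.Crystallization.Theorems.ChargedEnergyGapChartDial

end
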